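import Literature.Claims.NS.Haitani2025
import Mathlib.MeasureTheory.Integral.Marginal
import Mathlib.MeasureTheory.Measure.Haar.InnerProductSpace
import Mathlib.Analysis.Calculus.Deriv.Pi
import HarnessLib

/-!
# C133 `Haitani2025` — Poincaré in a slab of `ℝ³` (kernel lemmas for the Lemma 8 (16) p.4 addendum; part 1 of 2)

Part 1 of the dyadic Poincaré kit written by ns-claims-typist-4 g3 (records-only kit
`typist4-kit-PoincareCube.lean` a620f5152bf28770), split by topic under the 400-line lint and adopted by the C133
refuter of record ns-claims-refuter-3 g2 (proofs unchanged; the direction vector `eX0` made public for part 2):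
1-D Poincaré on `[a, a+h]` by FTC + Cauchy–Schwarz (`integral_norm_sq_le_of_deriv`: `∫_a^{a+h} ‖f‖² ≤ h² ∫ ‖f'‖²`
when `f a = 0`), its whole-line `lintegral` form (`lintegral_norm_sq_le_of_deriv`), and the transfer to `ℝ³` by
Fubini along the first coordinate via `MeasureTheory.lmarginal` through the volume-preserving `WithLp.toLp`
(`lintegral_sq_le_slab`: `∫ ‖ψ‖² ≤ h² ∫ ‖Dψ eX0‖²` for `ψ ∈ C¹` vanishing off the slab `c₀ ≤ x₀ ≤ c₀ + h`).
Part 2 (`SoloRefuteHaitani2025ShiftWeight.lean`): the dyadic-cube statement for Definition-1 wavelets and the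
refutation of the REF R#6 re-typing of Lemma 8 (16) p.4 for every wavelet system.
[cite: Haitani2025NavierStokesGitHub, Definition 1 p.2; Lemma 8 (16) p.4]

WHAT THIS IS NOT: not a claim about NS regularity or blow-up; not a claim about any author beyond the typed
locator.
-/

set_option linter.dupNamespace false

noncomputable section

namespace Summit.NavierStokesRegularity.NavierStokesRegularity.Theorems.Haitani2025

open Set MeasureTheory intervalIntegral Filter
open scoped ENNReal Topology
open Literature.Analysis.FluidPDE Literature.Claims.NS.Haitani2025 Literature.Claims.NS.Chio2026

/-! ## 1-D Poincaré on an interval -/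

section OneD

variable {E : Type*} [NormedAddCommGroup E] [NormedSpace ℝ E] [CompleteSpace E]

/-- Cauchy–Schwarz on an interval, quadratic-trick form: `(∫_a^x g)² ≤ (x − a) ∫_a^x g²`. [folklore] -/
private theorem sq_integral_le (g : ℝ → ℝ) (hg : Continuous g) {a x : ℝ} (hax : a ≤ x) :
    (∫ s in a..x, g s) ^ 2 ≤ (x - a) * ∫ s in a..x, g s ^ 2 := by
  rcases eq_or_lt_of_le hax with rfl | hlt
  · simp
  have hL : 0 < x - a := sub_pos.mpr hlt
  set I := ∫ s in a..x, g s with hI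
  set J := ∫ s in a..x, g s ^ 2 with hJ
  set m := I / (x - a) with hm
  have hgi : IntervalIntegrable g volume a x := hg.intervalIntegrable a x
  have hg2i : IntervalIntegrable (fun s => g s ^ 2) volume a x := (hg.pow 2).intervalIntegrable a x
  have hnn : 0 ≤ ∫ s in a..x, (g s - m) ^ 2 :=
    intervalIntegral.integral_nonneg hax fun s _ => sq_nonneg _
  have hexp : ∫ s in a..x, (g s - m) ^ 2 = J - 2 * m * I + m ^ 2 * (x - a) := by
    have h1 : (fun s => (g s - m) ^ 2) = fun s => g s ^ 2 - (2 * m) * g s + m ^ 2 := by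
      funext s; ring
    rw [h1, intervalIntegral.integral_add, intervalIntegral.integral_sub hg2i (hgi.const_mul _),
      intervalIntegral.integral_const_mul, intervalIntegral.integral_const]
    · simp [hI, hJ, smul_eq_mul]
      ring
    · exact hg2i.sub (hgi.const_mul _)
    · exact intervalIntegrable_const
  have key : 0 ≤ J - 2 * m * I + m ^ 2 * (x - a) := hexp ▸ hnn
  have hm' : 2 * m * I - m ^ 2 * (x - a) = I ^ 2 / (x - a) := by
    rw [hm]
    field_simp
    ring
  have : I ^ 2 / (x - a) ≤ J := by linarith
  calc I ^ 2 = (I ^ 2 / (x - a)) * (x - a) := by field_simp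
    _ ≤ J * (x - a) := by gcongr
    _ = (x - a) * J := by ring

/-- Pointwise: `‖f x‖² ≤ h ∫_a^{a+h} ‖f'‖²` on `[a, a+h]` when `f a = 0`, `f' ` continuous derivative. [folklore] -/
private theorem norm_sq_le_of_deriv (f f' : ℝ → E) (hf : ∀ t, HasDerivAt f (f' t) t)
    (hf' : Continuous f') {a h : ℝ} (hh : 0 ≤ h) (hfa : f a = 0) {x : ℝ} (hx : x ∈ Icc a (a + h)) :
    ‖f x‖ ^ 2 ≤ h * ∫ s in a..a + h, ‖f' s‖ ^ 2 := by
  have hax : a ≤ x := hx.1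
  have hftc : f x = ∫ s in a..x, f' s := by
    rw [intervalIntegral.integral_eq_sub_of_hasDerivAt (fun s _ => hf s)
      (hf'.intervalIntegrable a x), hfa, sub_zero]
  have h1 : ‖f x‖ ≤ ∫ s in a..x, ‖f' s‖ := by
    rw [hftc]
    exact intervalIntegral.norm_integral_le_integral_norm hax
  have h2 : (∫ s in a..x, ‖f' s‖) ^ 2 ≤ (x - a) * ∫ s in a..x, ‖f' s‖ ^ 2 :=
    sq_integral_le _ (continuous_norm.comp hf') hax
  have h3 : (∫ s in a..x, ‖f' s‖ ^ 2) ≤ ∫ s in a..a + h, ‖f' s‖ ^ 2 := by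
    have hi : IntervalIntegrable (fun s => ‖f' s‖ ^ 2) volume a (a + h) :=
      ((continuous_norm.comp hf').pow 2).intervalIntegrable _ _
    exact intervalIntegral.integral_mono_interval (le_refl a) hax hx.2
      (Filter.Eventually.of_forall fun s => sq_nonneg _) hi
  have hxa : x - a ≤ h := by linarith [hx.2]
  have hJ : 0 ≤ ∫ s in a..x, ‖f' s‖ ^ 2 :=
    intervalIntegral.integral_nonneg hax fun s _ => sq_nonneg _
  calc ‖f x‖ ^ 2 ≤ (∫ s in a..x, ‖f' s‖) ^ 2 := pow_le_pow_left₀ (norm_nonneg _) h1 2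
    _ ≤ (x - a) * ∫ s in a..x, ‖f' s‖ ^ 2 := h2
    _ ≤ h * ∫ s in a..a + h, ‖f' s‖ ^ 2 := mul_le_mul hxa h3 hJ hh

/-- **1-D Poincaré**: `∫_a^{a+h} ‖f‖² ≤ h² ∫_a^{a+h} ‖f'‖²` when `f a = 0`. [folklore] -/
theorem integral_norm_sq_le_of_deriv (f f' : ℝ → E) (hf : ∀ t, HasDerivAt f (f' t) t)
    (hf' : Continuous f') {a h : ℝ} (hh : 0 ≤ h) (hfa : f a = 0) :
    (∫ x in a..a + h, ‖f x‖ ^ 2) ≤ h ^ 2 * ∫ s in a..a + h, ‖f' s‖ ^ 2 := by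
  have hfc : Continuous f := continuous_iff_continuousAt.mpr fun t => (hf t).continuousAt
  have hb : ∀ x ∈ Icc a (a + h), ‖f x‖ ^ 2 ≤ h * ∫ s in a..a + h, ‖f' s‖ ^ 2 :=
    fun x hx => norm_sq_le_of_deriv f f' hf hf' hh hfa hx
  calc (∫ x in a..a + h, ‖f x‖ ^ 2)
      ≤ ∫ x in a..a + h, h * ∫ s in a..a + h, ‖f' s‖ ^ 2 :=
        intervalIntegral.integral_mono_on (by linarith) ((hfc.norm.pow 2).intervalIntegrable _ _)
          intervalIntegrable_const hb
    _ = h ^ 2 * ∫ s in a..a + h, ‖f' s‖ ^ 2 := by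
        rw [intervalIntegral.integral_const, smul_eq_mul]
        ring

omit [NormedSpace ℝ E] [CompleteSpace E] in
/-- A continuous function vanishing on `(-∞, a)` vanishes at `a`. [folklore] -/
private theorem eq_zero_of_eq_zero_lt (f : ℝ → E) (hfc : Continuous f) {a : ℝ}
    (h : ∀ t, t < a → f t = 0) : f a = 0 := by
  have h1 : Tendsto f (𝓝[<] a) (𝓝 (f a)) := (hfc.tendsto a).mono_left nhdsWithin_le_nhds
  have h2 : Tendsto f (𝓝[<] a) (𝓝 0) := by
    apply tendsto_const_nhds.congr'
    filter_upwards [self_mem_nhdsWithin] with t ht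
    exact (h t ht).symm
  exact tendsto_nhds_unique h1 h2

/-- **1-D Poincaré, whole-line `lintegral` form** for a function vanishing outside `[a, a+h]`:
`∫⁻ ‖f‖² ≤ h² · ∫⁻ ‖f'‖²`. [folklore] -/
theorem lintegral_norm_sq_le_of_deriv (f f' : ℝ → E) (hf : ∀ t, HasDerivAt f (f' t) t)
    (hf' : Continuous f') {a h : ℝ} (hh : 0 ≤ h) (hzero : ∀ t, t ∉ Icc a (a + h) → f t = 0) :
    ∫⁻ t, ENNReal.ofReal (‖f t‖ ^ 2) ≤ ENNReal.ofReal (h ^ 2) * ∫⁻ t, ENNReal.ofReal (‖f' t‖ ^ 2) := by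
  have hfc : Continuous f := continuous_iff_continuousAt.mpr fun t => (hf t).continuousAt
  have hfa : f a = 0 := eq_zero_of_eq_zero_lt f hfc fun t ht => hzero t fun ht' => by
    exact absurd ht'.1 (not_le.mpr ht)
  -- the real inequality on [a, a+h]
  have hreal := integral_norm_sq_le_of_deriv f f' hf hf' hh hfa
  -- LHS: ∫⁻ ‖f‖² = ofReal (∫_a^{a+h} ‖f‖²)
  have hsupp : Function.support (fun t => ‖f t‖ ^ 2) ⊆ Ioc a (a + h) := by
    intro t ht
    rw [Function.mem_support] at ht
    by_contra hnot
    apply ht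
    have : f t = 0 := by
      by_cases hta : t = a
      · rw [hta, hfa]
      · apply hzero t
        intro htI
        exact hnot ⟨lt_of_le_of_ne htI.1 (Ne.symm hta), htI.2⟩
    rw [this, norm_zero, zero_pow two_ne_zero]
  have hcomp : HasCompactSupport (fun t => ‖f t‖ ^ 2) :=
    HasCompactSupport.intro isCompact_Icc fun t ht => by
      have : f t = 0 := hzero t ht
      simp [this]
  have hint : Integrable (fun t => ‖f t‖ ^ 2) := (hfc.norm.pow 2).integrable_of_hasCompactSupport hcomp
  have hL : ∫⁻ t, ENNReal.ofReal (‖f t‖ ^ 2) = ENNReal.ofReal (∫ x in a..a + h, ‖f x‖ ^ 2) := by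
    rw [intervalIntegral.integral_eq_integral_of_support_subset hsupp,
      MeasureTheory.ofReal_integral_eq_lintegral_ofReal hint (Eventually.of_forall fun t => sq_nonneg _)]
  -- RHS: ∫⁻ ‖f'‖² ≥ ofReal (∫_a^{a+h} ‖f'‖²)
  have hint' : IntegrableOn (fun t => ‖f' t‖ ^ 2) (Ioc a (a + h)) :=
    ((continuous_norm.comp hf').pow 2).integrableOn_Icc.mono_set Ioc_subset_Icc_self
  have hR : ENNReal.ofReal (∫ s in a..a + h, ‖f' s‖ ^ 2) ≤ ∫⁻ t, ENNReal.ofReal (‖f' t‖ ^ 2) := by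
    rw [intervalIntegral.integral_of_le (by linarith),
      MeasureTheory.ofReal_integral_eq_lintegral_ofReal hint' (Eventually.of_forall fun t => sq_nonneg _)]
    exact MeasureTheory.setLIntegral_le_lintegral _ _
  calc ∫⁻ t, ENNReal.ofReal (‖f t‖ ^ 2) = ENNReal.ofReal (∫ x in a..a + h, ‖f x‖ ^ 2) := hL
    _ ≤ ENNReal.ofReal (h ^ 2 * ∫ s in a..a + h, ‖f' s‖ ^ 2) := ENNReal.ofReal_le_ofReal hreal
    _ = ENNReal.ofReal (h ^ 2) * ENNReal.ofReal (∫ s in a..a + h, ‖f' s‖ ^ 2) :=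
        ENNReal.ofReal_mul (sq_nonneg _)
    _ ≤ ENNReal.ofReal (h ^ 2) * ∫⁻ t, ENNReal.ofReal (‖f' t‖ ^ 2) := by gcongr

end OneD

/-! ## Transfer to `ℝ³`: Poincaré in the slab `c₀ ≤ x₀ ≤ c₀ + h` -/

section ThreeD

/-- The coordinate direction `e₀`. [folklore] -/
def eX0 : E3 := EuclideanSpace.single (0 : Fin 3) (1 : ℝ)

/-- `toLp 2` as a continuous linear map `(Fin 3 → ℝ) →L[ℝ] ℝ³`. [folklore] -/
private def L3 : (Fin 3 → ℝ) →L[ℝ] E3 :=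
  ((PiLp.continuousLinearEquiv 2 ℝ (fun _ : Fin 3 => ℝ)).symm : (Fin 3 → ℝ) ≃L[ℝ] E3)

/-- `L3` is `toLp 2`. [folklore] -/
private theorem L3_apply (y : Fin 3 → ℝ) : L3 y = WithLp.toLp 2 y := rfl

/-- `L3` maps the first coordinate vector to `eX0`. [folklore] -/
private theorem L3_single : L3 (Pi.single 0 1) = eX0 := rfl

/-- The line derivative: `d/dt ψ(toLp (update y 0 t)) = Dψ(·) e₀`. [folklore] -/
private theorem hasDerivAt_line (ψ : E3 → E3) (hψ : ContDiff ℝ 1 ψ) (y : Fin 3 → ℝ) (t : ℝ) :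
    HasDerivAt (fun s => ψ (WithLp.toLp 2 (Function.update y 0 s)))
      (fderiv ℝ ψ (WithLp.toLp 2 (Function.update y 0 t)) eX0) t := by
  have h1 : HasDerivAt (fun s => L3 (Function.update y 0 s)) (L3 (Pi.single 0 1)) t :=
    L3.hasFDerivAt.comp_hasDerivAt t (hasDerivAt_update y 0 t)
  have h2 := ((hψ.differentiable one_ne_zero) (L3 (Function.update y 0 t))).hasFDerivAt.comp_hasDerivAt t h1
  rw [L3_single] at h2
  exact h2

/-- **Slab Poincaré in `ℝ³` (`lintegral` form).** If `ψ ∈ C¹(ℝ³; ℝ³)` vanishes at every point whose first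
coordinate lies outside `[c₀, c₀ + h]`, then `∫ ‖ψ‖² ≤ h² ∫ ‖Dψ e₀‖²`. Fubini along the first coordinate
(`lmarginal`) + the 1-D inequality on each line. [folklore] -/
theorem lintegral_sq_le_slab (ψ : E3 → E3) (hψ : ContDiff ℝ 1 ψ) (c₀ h : ℝ) (hh : 0 ≤ h)
    (hzero : ∀ x : E3, x 0 ∉ Icc c₀ (c₀ + h) → ψ x = 0) :
    ∫⁻ x, ENNReal.ofReal (‖ψ x‖ ^ 2) ≤
      ENNReal.ofReal (h ^ 2) * ∫⁻ x, ENNReal.ofReal (‖fderiv ℝ ψ x eX0‖ ^ 2) := by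
  have hcontD : Continuous (fderiv ℝ ψ) := hψ.continuous_fderiv one_ne_zero
  -- the two integrands on the coordinate space
  set F : (Fin 3 → ℝ) → ℝ≥0∞ := fun y => ENNReal.ofReal (‖ψ (WithLp.toLp 2 y)‖ ^ 2) with hF
  set G : (Fin 3 → ℝ) → ℝ≥0∞ :=
    fun y => ENNReal.ofReal (h ^ 2) * ENNReal.ofReal (‖fderiv ℝ ψ (WithLp.toLp 2 y) eX0‖ ^ 2) with hG
  have hcontL : Continuous fun y : Fin 3 → ℝ => WithLp.toLp 2 y := L3.continuous
  have hFm : Measurable F := by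
    refine ENNReal.measurable_ofReal.comp ?_
    exact ((hψ.continuous.comp hcontL).norm.pow 2).measurable
  have hGm : Measurable G := by
    refine Measurable.const_mul (ENNReal.measurable_ofReal.comp ?_) _
    exact (((hcontD.comp hcontL).clm_apply continuous_const).norm.pow 2).measurable
  -- single-coordinate comparison
  have hmarg : ∫⋯∫⁻_{0}, F ∂(fun _ : Fin 3 => (volume : Measure ℝ)) ≤
      ∫⋯∫⁻_{0}, G ∂(fun _ : Fin 3 => (volume : Measure ℝ)) := by
    rw [lmarginal_singleton, lmarginal_singleton]
    intro y
    show ∫⁻ s, F (Function.update y 0 s) ≤ ∫⁻ s, G (Function.update y 0 s)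
    have h1 := lintegral_norm_sq_le_of_deriv
      (fun s => ψ (WithLp.toLp 2 (Function.update y 0 s)))
      (fun s => fderiv ℝ ψ (WithLp.toLp 2 (Function.update y 0 s)) eX0)
      (hasDerivAt_line ψ hψ y)
      (((hcontD.comp (hcontL.comp (by fun_prop))).clm_apply continuous_const)) hh
      (a := c₀) (fun s hs => hzero _ (by simpa [PiLp.toLp_apply] using hs))
    have h2 : ∫⁻ s, G (Function.update y 0 s) =
        ENNReal.ofReal (h ^ 2) *
          ∫⁻ s, ENNReal.ofReal (‖fderiv ℝ ψ (WithLp.toLp 2 (Function.update y 0 s)) eX0‖ ^ 2) := by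
      rw [hG]
      exact lintegral_const_mul' _ _ ENNReal.ofReal_ne_top
    rw [h2]
    exact h1
  have hpi : ∫⁻ y, F y ≤ ∫⁻ y, G y := by
    rw [MeasureTheory.volume_pi]
    exact lintegral_le_of_lmarginal_le {0} hFm hGm hmarg
  -- transfer to `ℝ³` through the volume-preserving `toLp`
  have hmp := PiLp.volume_preserving_toLp (Fin 3)
  have hemb : MeasurableEmbedding (WithLp.toLp 2 : (Fin 3 → ℝ) → E3) :=
    (MeasurableEquiv.toLp 2 (Fin 3 → ℝ)).measurableEmbedding
  have hF' : ∫⁻ y, F y = ∫⁻ x, ENNReal.ofReal (‖ψ x‖ ^ 2) :=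
    hmp.lintegral_comp_emb hemb (fun x => ENNReal.ofReal (‖ψ x‖ ^ 2))
  have hG' : ∫⁻ y, G y = ENNReal.ofReal (h ^ 2) * ∫⁻ x, ENNReal.ofReal (‖fderiv ℝ ψ x eX0‖ ^ 2) := by
    rw [hG, lintegral_const_mul' _ _ ENNReal.ofReal_ne_top]
    rw [hmp.lintegral_comp_emb hemb (fun x => ENNReal.ofReal (‖fderiv ℝ ψ x eX0‖ ^ 2))]
  rw [← hF', ← hG']
  exact hpi

end ThreeD

end Summit.NavierStokesRegularity.NavierStokesRegularity.Theorems.Haitani2025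

end

-- WHAT THIS IS NOT: not a claim about NS regularity or blow-up; not a claim about any author beyond the typed
-- locator.
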